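import Mathlib
import HarnessLib

/-!
# Magnen–Rivasseau–Sénéor, *Construction of YM₄ with an infrared cutoff* (CMP 155, 1993), §II.A «The Starting
# Ansatz» — the bare-coupling ansatz (II.11)–(II.12), the class of «stabilizing» ultraviolet cutoffs (II.13)–(II.15)
# and the anisotropic index set **P** (p.334), typed AS PRINTED as real definitions with bodies

statement-level skeleton of published definitions with citation tags; elementary API proved; nothing here is a claim
about the Yang–Mills mass gap, about the continuum limit on `T⁴`, or about the Clay problem

**Citation header (reproduction of PUBLISHED work).** J. Magnen, V. Rivasseau, R. Sénéor, *Construction of YM₄ with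
an infrared cutoff*, Commun. Math. Phys. **155** (1993) 325–383 [MagnenRivasseauSeneor1993], Sect. II.A «The Model,
Notations», pp. 328–334, and the first paragraph of Sect. II.B, p. 334. Loci `p.NNN tl.nn` = journal page and
text-layer line of the held Project-Euclid scan `paper:magnen1993-cmp155-mrs-ym4-infrared-cutoff` (PDF page = journal
page − 324); every display quoted below was read on the decoded page IMAGES (600 dpi CCITT scan; renders of record
`run/shared/lean/pub/lit-balaban/inprint/lit-balaban-p14/renders-cmp155/`, crops made for this file under the seat
folder of unit `pub-balaban-gaps-mrs-lit-1`), because the OCR text layer garbles the displays. Cell pub-balaban-gaps,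
track G3 (MRS 1993 as the independent second ultraviolet route), seat mrs-lit-1; companion prose
`run/shared/lean/pub/pub-balaban-gaps/g3/MRS-AS-PRINTED.md`. Sibling modules: `…MRS93OneLoopCounterterms` (Sect. III
arithmetic, kernel-checked) and `…MRS93MainStatement` (the main statement p. 327 as a typed skeleton).

**What the paper prints (verbatim).**
* p.330 tl.14–15: *«We want to have a well defined functional integral to start with. The scale of our ultraviolet
  cutoff is called M^ρ, and the ultraviolet limit is when ρ → ∞.»*
* (II.11) p.330 tl.16–22: *«From standard renormalization group analysis we learn that in order to get a finite
  non-trivial renormalized theory at the unit scale of our finite box, we should use a bare coupling constant which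
  has the usual asymptotic behavior with ρ implied by asymptotic freedom. Hence a good ansatz for the bare coupling
  λ_ρ should be: λ_ρ² = 1 / (−β₂(Log M)ρ + β₃/β₂ log ρ + C), (II.11) where C is a large constant, and β₂ and β₃ are
  the usual first non-vanishing coefficients of the β function, whose numerical value is given in standard textbooks
  like [IZ].»* tl.23–26: *«Then one hopes that the renormalized coupling constant λ_ren, which should be defined as
  the last one in a sequence of effective constants, is finite and arbitrarily small as C becomes arbitrarily large
  (if perturbative renormalization group analysis turns out to be correct).»*
* (II.12) p.330 tl.26–27: *«Let us define first the tentative effective coupling at scale i as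
  (λ_i^t)² ≡ 1 / (−β₂(ln M) i + β₃/β₂ ln i + C).»* tl.28–30: *«Later (in Sect. V) we will have performed the
  necessary expansions to compute the flow of exact effective coupling constants λ_i^{eff} which will be very close
  to the tentative ones.»* (That flow is ASSERTED by reference in Sect. V.E, p.366 tl.2–11 — lit-balaban YM-INPRINT
  row D1, Q1 = NO; nothing of it is typed here.)
* p.330 tl.31–34: *«The class of ultraviolet cutoffs we consider is defined as follows. τ is a fixed function which
  is between 0 and 1, is 1 near 0 and decreases at infinity. For instance we take a one variable C₀^∞ function,
  monotone decreasing, which is 0 for x ≥ 2 and is 1 for x ≤ 1»* (the sentence continues: the monotone decreasing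
  and C₀^∞ character *«are perhaps not essential but it is important that the slices built out of this cutoff by the
  scaling process defined below have good spatial decay»*).
* (II.13)–(II.14) p.331 tl.2–9: *«Then we define our scaled momentum cutoff κ_ρ to be: κ_ρ(p) = κ(pM^{−ρ}), (II.13)
  where κ is the following function: κ(p) ≡ 1 if |p| ≤ 1, κ(p) ≡ (1 + τ(|p|))/2 if 1 < |p| ≤ 2, κ(p) ≡ 1/2 if
  2 < |p| ≤ 2 + η⁻¹, κ(p) ≡ (1/2)τ(|p| − 1 − η⁻¹) if 2 + η⁻¹ < |p|, (II.14) where η is a small constant. This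
  unusual form, shown in Fig. II.1 leads to a stabilizing A⁴ counterterm whose strength can be made as large as
  desired and to a stabilizing functional integral for large background fields; both effects are obtained by taking
  η sufficiently small as shown in Sect. III.»* (Fig. II.1 «The ultraviolet cutoff»: plateaux 1 on [0, 1] and 1/2 on
  [2, 2 + η⁻¹], abscissa marks 1, 2, 2 + η⁻¹, 3 + η⁻¹.)
* (II.15) p.331 tl.16–17: *«We write also κ^i = κ_i − κ_{i−1} if i ≥ 1; κ⁰ = κ₀.»*
* p.334 tl.44–49 (Sect. II.B): *«For every value of i = 1, …, ρ₁ we introduce an index α with integer values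
  between N_i and i+1, where N_i is the integer part of i − |ln(λ_i^t)/ln M| (this rule seems obscure but is
  introduced because when |p| is of order M^i we want to decompose p₀ between λM^i and M^{i+1}). The full set of
  ordered pairs (i, α) is called 𝐏, and the letter j is used for a typical pair (i, α) of 𝐏. On this set we
  introduce an ordering relation, namely we say that j′ = (i′, α′) < j = (i, α) iff i′ < i or i′ = i and
  α′ < α.»*

**What is typed here (definitions with bodies; elementary API kernel-checked, zero `sorry`, zero named facts).**
* §1 `bareCouplingSq β₂ β₃ M C ρ` = the right-hand side of (II.11) as a real function of a real `ρ`, and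
  `tentativeCouplingSq … i` = (II.12) (`tentativeCouplingSq_eq`: it IS (II.11) read at `ρ = i` — the print uses
  «Log» in (II.11) and «ln» in (II.12) for the same natural logarithm, both rendered `Real.log`). API: the printed
  words «asymptotic behavior with ρ implied by asymptotic freedom» made checkable — **`tendsto_bareCouplingSq_zero`**:
  if `β₂ < 0` and `1 < M` then `λ_ρ² → 0` as `ρ → ∞`, and `bareCouplingSq_pos_eventually` (the denominator is
  eventually positive), whatever `β₃`, `C`. The SIGN CONVENTION is the print's: (II.11) is asymptotically free iff
  `−β₂ Log M > 0`, i.e. `β₂ < 0` for `M > 1`; the values of `β₂`, `β₃` («given in standard textbooks like [IZ]»)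
  are NOT typed — they are parameters.
* §2 `CutoffProfile` = the reference function `τ` with exactly the four printed properties (C^∞ — rendered
  `ContDiff ℝ n` for every `n : ℕ∞` —, monotone decreasing, `= 0` for `x ≥ 2`, `= 1` for `x ≤ 1`), the derived
  bounds `0 ≤ τ ≤ 1`, and a WITNESS `CutoffProfile.standard` (`x ↦ Real.smoothTransition (2 − x)`, Mathlib) showing
  the class is inhabited. `cutoffFn P η r` = κ of (II.14) as a function of `r = |p|` (the print's κ is radial), with
  the four region lemmas (`cutoffFn_of_le_one`, `_of_one_lt_of_le_two`, `_plateau`, `_tail`), the junction values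
  `cutoffFn_one = 1`, `cutoffFn_two = 1/2`, `cutoffFn_plateau_end = 1/2` (the four pieces MATCH at `1`, `2`,
  `2 + η⁻¹` — the continuity visible in Fig. II.1), `cutoffFn_eq_zero_of_le` (`κ = 0` for `|p| ≥ 3 + η⁻¹`, the
  last abscissa mark of Fig. II.1), and `cutoffFn_nonneg`, `cutoffFn_le_one`.
* §3 `scaledCutoff P η M ρ r = κ(r M^{−ρ})` (II.13) and `sliceCutoff` (II.15) with the telescoping identity
  **`sum_sliceCutoff`** `∑_{i ≤ ρ} κ^i = κ_ρ` (the partition of the cutoff into slices that (II.16)–(II.19) and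
  (II.22) sum over).
* §4 `lowIndex M lam i = N_i` = «the integer part of i − |ln(λ_i^t)/ln M|» (rendered `⌊·⌋`), the index set
  `indexSet M lam ρ₁ = 𝐏 ⊆ ℕ × ℤ` and `indexSet_lt_iff`: the printed ordering relation is the lexicographic order
  (`Prod.Lex`).

**v1.1 (same seat, append-only).** §5 THE SLICING IS A GENUINE PARTITION: with «monotone decreasing» τ the
cutoff κ of (II.14) is itself monotone decreasing in `|p|` (**`cutoffFn_antitone`**, `η > 0`; the four pieces
decrease and match at the junctions — Fig. II.1), `κ ≤ 1/2` beyond `|p| = 2` (`cutoffFn_le_half_of_two_lt`); hence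
the slices (II.15) are NONNEGATIVE (`sliceCutoff_nonneg`, for `M ≥ 1`, `|p| ≥ 0`) and bounded by `1`
(`sliceCutoff_le_one`), and slice `i + 1` is SUPPORTED in the momentum shell `M^i < |p| < (3 + η⁻¹)M^{i+1}`
(`sliceCutoff_succ_eq_zero_of_le`, `sliceCutoff_succ_eq_zero_of_ge`) — the «slices built out of this cutoff by
the scaling process» (p.330 tl.35) that carry momenta of order `M^i`. Docstring clause added on «C₀^∞» (cell
referee REF-G3-v1): with `τ ≡ 1` on `x ≤ 1` the subscript `0` cannot mean compact support on `ℝ`; as a profile of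
`|p| ≥ 0` composed into (II.14) only smoothness matters, which is what `CutoffProfile.contDiff` records.

**v1.2 (same seat, append-only).** §6 THE COVARIANCE SYMBOLS (II.16), (II.19): `invC0` = the momentum-space
symbol `p² Σ_{i ≤ ρ₁} (λ_i^t)² κ^i(p)` of `C₀⁻¹` (*«Σ_i (λ_i^t)²⟨A, p²κ^i(p)A⟩ = ⟨A, C₀⁻¹A⟩ (II.16)»*, p.332 tl.3–4,
the sum stopping at `ρ₁` as in (II.18), p.332 tl.20–21) and `invCaxial = p₀² + invC0` (*«⟨A, p₀²A⟩ + Σ_i (λ_i^t)²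
⟨Ap²κ^i(p)A⟩ = ⟨A, C_axial⁻¹A⟩ (II.19)»*, p.332 tl.22–23), as real functions of `(p₀, |p|²)`; PROVED: `invC0_nonneg`
(slices ≥ 0), `invCaxial_pos` for `p₀ ≠ 0` (the printed point of adding the term: *«The quadratic form p₀² is not
invertible when p₀ = 0 and in order to have a good propagator we add and subtract Σ_i(λ_i^t)²⟨A, p²κ^i(p)A⟩»*,
p.331 tl.18–19), `invC0_of_sq_le_one` (below the unit scale only slice `0` contributes: `= p²(λ_0^t)²`), and
`invC0_eq_zero_of_ge` (the symbol vanishes beyond the support `(3 + η⁻¹)M^{ρ₁}` of the fake cutoff — there the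
Gaussian measure `dμ_{0,ρ₁}` carries no modes).

**Readings (declared).** (i) `ρ`, `i` are natural-number scale indices in the paper (slices `i = 1, …, ρ`); (II.11)
is typed over a real `ρ` so that the limit `ρ → ∞` and (II.12) are the same function; `Real.log 0 = 0` makes the
`i = 0` value harmless junk (`= 1/C`), never used. (ii) «integer part» = floor `⌊·⌋` (for the negative arguments that
occur when `|ln λ_i^t| > i ln M` the print does not say which integer part; floor is our reading, flagged). (iii) The
momentum `p` lives on the dual lattice `Λ* = ℤ⁴` of the torus (p.328 tl.12–13); κ depends on `|p|` only, so the
cutoff is typed as a function of the real variable `r = |p| ≥ 0`; its values at `r < 0` are junk (`= 1`).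
(iv) `η > 0` is needed only where `η⁻¹` must exceed `0` (`cutoffFn_plateau`, `…_tail`); the definitions take any `η`.

**What is NOT claimed or typed.** The anisotropic slices (II.21a/b) p.335 (the print reads
«κ^j(p) = κ^{i,α}(p, p₀) = κ^i(p)κ^{N_i}(p₀)» for `α ≠ N_i` — right-hand side independent of `α` as printed; not
typed, not corrected); the propagators `C₀`, `C_axial` (II.16)–(II.19) and every functional integral of §II
((II.17), (II.18), (II.35)–(II.40), (II.49), (II.78)) — they are Gaussian measures on distributions perturbed by
non-integrable densities, «formal» by the authors' own word (p.332 tl.10–12, tl.21), and are carried ABSTRACTLY in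
`…MRS93MainStatement`; the small/large field expansion (II.25)–(II.31); the value of `β₂`, `β₃`; the flow of the
effective couplings (Sect. V.E, asserted in print, not proved); anything about Bałaban's lattice programme.
-/

noncomputable section

open Filter Topology Set Finset

namespace Literature.MathematicalPhysics.QuantumFieldTheory.MagnenRivasseauSeneor1993

namespace Ansatz

/-! ## §1 The bare-coupling ansatz (II.11) and the tentative effective couplings (II.12) -/

/-- (II.11): *«λ_ρ² = 1 / (−β₂(Log M)ρ + β₃/β₂ log ρ + C), where C is a large constant, and β₂ and β₃ are the usual
first non-vanishing coefficients of the β function»* — the right-hand side as a function of the ultraviolet-cutoff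
index `ρ` (scale `M^ρ`), for parameters `β₂ β₃ M C`. [cite: MagnenRivasseauSeneor1993, (II.11) p.330] -/
def bareCouplingSq (β₂ β₃ M C : ℝ) (ρ : ℝ) : ℝ :=
  1 / (-β₂ * Real.log M * ρ + β₃ / β₂ * Real.log ρ + C)

/-- (II.12): *«the tentative effective coupling at scale i … (λ_i^t)² ≡ 1 / (−β₂(ln M) i + β₃/β₂ ln i + C)»*.
[cite: MagnenRivasseauSeneor1993, (II.12) p.330] -/
def tentativeCouplingSq (β₂ β₃ M C : ℝ) (i : ℕ) : ℝ :=
  1 / (-β₂ * Real.log M * i + β₃ / β₂ * Real.log i + C)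

/-- (II.12) is (II.11) read at the integer scale `ρ = i`. [cite: MagnenRivasseauSeneor1993, (II.11)–(II.12) p.330] -/
theorem tentativeCouplingSq_eq (β₂ β₃ M C : ℝ) (i : ℕ) :
    tentativeCouplingSq β₂ β₃ M C i = bareCouplingSq β₂ β₃ M C i := rfl

/-- The denominator of (II.11). [cite: MagnenRivasseauSeneor1993, (II.11) p.330] -/
def bareDenom (β₂ β₃ M C : ℝ) (ρ : ℝ) : ℝ := -β₂ * Real.log M * ρ + β₃ / β₂ * Real.log ρ + C

/-- (II.11) as an inverse. [cite: MagnenRivasseauSeneor1993, (II.11) p.330] -/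
theorem bareCouplingSq_eq_inv (β₂ β₃ M C ρ : ℝ) :
    bareCouplingSq β₂ β₃ M C ρ = (bareDenom β₂ β₃ M C ρ)⁻¹ := by
  simp [bareCouplingSq, bareDenom]

/-- «asymptotic behavior with ρ implied by asymptotic freedom» (p.330 tl.18–19), the elementary half: for `β₂ < 0`
and `M > 1` the denominator of (II.11) tends to `+∞` with `ρ` (the linear term `−β₂(Log M)ρ` dominates
`(β₃/β₂) log ρ`, whatever the signs of `β₃`, `C`). [cite: MagnenRivasseauSeneor1993, (II.11) p.330] -/
theorem tendsto_bareDenom_atTop {β₂ M : ℝ} (β₃ C : ℝ) (hβ₂ : β₂ < 0) (hM : 1 < M) :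
    Tendsto (bareDenom β₂ β₃ M C) atTop atTop := by
  have ha : 0 < -β₂ * Real.log M := mul_pos (neg_pos.mpr hβ₂) (Real.log_pos hM)
  set a := -β₂ * Real.log M with ha_def
  set b := β₃ / β₂ with hb_def
  -- `log ρ = o(ρ)`: eventually `|b log ρ| ≤ (a/2) ρ`.
  have hlo := Real.isLittleO_log_id_atTop
  have hε : 0 < a / 2 / (|b| + 1) := by positivity
  have hev : ∀ᶠ ρ in atTop, (a / 2) * ρ + C ≤ bareDenom β₂ β₃ M C ρ := by
    filter_upwards [hlo.def hε, eventually_ge_atTop (0 : ℝ)] with ρ hρ hρ0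
    have h1 : |b * Real.log ρ| ≤ (a / 2) * ρ := by
      rw [abs_mul]
      calc |b| * |Real.log ρ| ≤ |b| * (a / 2 / (|b| + 1) * ‖ρ‖) := by
            have := hρ; simp only [id, Real.norm_eq_abs] at this ⊢
            exact mul_le_mul_of_nonneg_left this (abs_nonneg b)
        _ = (|b| / (|b| + 1)) * ((a / 2) * |ρ|) := by rw [Real.norm_eq_abs]; ring
        _ ≤ 1 * ((a / 2) * |ρ|) := by
            apply mul_le_mul_of_nonneg_right _ (by positivity)
            rw [div_le_one (by positivity)]; linarith [abs_nonneg b]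
        _ = (a / 2) * ρ := by rw [one_mul, abs_of_nonneg hρ0]
    have h2 : -((a / 2) * ρ) ≤ b * Real.log ρ := by
      have := neg_abs_le (b * Real.log ρ); linarith
    unfold bareDenom
    rw [← ha_def, ← hb_def]
    linarith
  refine tendsto_atTop_mono' atTop hev ?_
  exact tendsto_atTop_add_const_right _ _ (Tendsto.const_mul_atTop (by positivity) tendsto_id)

/-- Asymptotic freedom of the ansatz (II.11): for `β₂ < 0`, `M > 1` the bare coupling `λ_ρ²` tends to `0` as the
ultraviolet cutoff `ρ → ∞`. [cite: MagnenRivasseauSeneor1993, (II.11) p.330] -/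
theorem tendsto_bareCouplingSq_zero {β₂ M : ℝ} (β₃ C : ℝ) (hβ₂ : β₂ < 0) (hM : 1 < M) :
    Tendsto (bareCouplingSq β₂ β₃ M C) atTop (𝓝 0) := by
  have h := (tendsto_bareDenom_atTop β₃ C hβ₂ hM).inv_tendsto_atTop
  refine h.congr' ?_
  filter_upwards with ρ
  rw [bareCouplingSq_eq_inv]; rfl

/-- For `β₂ < 0`, `M > 1` the ansatz (II.11) is eventually a genuine positive square: `0 < λ_ρ²` for all large `ρ`.
[cite: MagnenRivasseauSeneor1993, (II.11) p.330] -/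
theorem bareCouplingSq_pos_eventually {β₂ M : ℝ} (β₃ C : ℝ) (hβ₂ : β₂ < 0) (hM : 1 < M) :
    ∀ᶠ ρ in atTop, 0 < bareCouplingSq β₂ β₃ M C ρ := by
  filter_upwards [(tendsto_bareDenom_atTop β₃ C hβ₂ hM).eventually_gt_atTop 0] with ρ hρ
  rw [bareCouplingSq_eq_inv]
  exact inv_pos.mpr hρ

/-! ## §2 The reference profile `τ` and the stabilizing cutoff `κ` of (II.14) -/

/-- The reference function `τ` of the cutoff class, with exactly the printed properties: *«a one variable C₀^∞
function, monotone decreasing, which is 0 for x ≥ 2 and is 1 for x ≤ 1»* (p.330 tl.31–34). (On «C₀^∞»: with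
`τ ≡ 1` on `x ≤ 1` the subscript cannot mean compact support on `ℝ`; only smoothness is recorded, `contDiff`.)
[cite: MagnenRivasseauSeneor1993, §II.A p.330] -/
structure CutoffProfile where
  /-- the profile `τ : ℝ → ℝ` -/
  τ : ℝ → ℝ
  /-- «C^∞» -/
  contDiff : ∀ n : ℕ∞, ContDiff ℝ n τ
  /-- «monotone decreasing» -/
  antitone : Antitone τ
  /-- «is 1 for x ≤ 1» -/
  eq_one_of_le_one : ∀ x, x ≤ 1 → τ x = 1
  /-- «is 0 for x ≥ 2» -/
  eq_zero_of_two_le : ∀ x, 2 ≤ x → τ x = 0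

namespace CutoffProfile

variable (P : CutoffProfile)

/-- `τ` is «between 0 and 1» (p.330 tl.31–32): lower bound, derived from the printed properties.
[cite: MagnenRivasseauSeneor1993, §II.A p.330] -/
theorem τ_nonneg (x : ℝ) : 0 ≤ P.τ x := by
  rcases le_or_gt x 2 with h | h
  · rw [← P.eq_zero_of_two_le 2 le_rfl]; exact P.antitone h
  · rw [P.eq_zero_of_two_le x h.le]

/-- `τ` is «between 0 and 1» (p.330 tl.31–32): upper bound. [cite: MagnenRivasseauSeneor1993, §II.A p.330] -/
theorem τ_le_one (x : ℝ) : P.τ x ≤ 1 := by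
  rcases le_or_gt x 1 with h | h
  · rw [P.eq_one_of_le_one x h]
  · rw [← P.eq_one_of_le_one 1 le_rfl]; exact P.antitone h.le

/-- `τ(1) = 1`. [cite: MagnenRivasseauSeneor1993, §II.A p.330] -/
theorem τ_one : P.τ 1 = 1 := P.eq_one_of_le_one 1 le_rfl

/-- `τ(2) = 0`. [cite: MagnenRivasseauSeneor1993, §II.A p.330] -/
theorem τ_two : P.τ 2 = 0 := P.eq_zero_of_two_le 2 le_rfl

/-- A witness that the printed class is inhabited: `τ(x) = smoothTransition(2 − x)` (Mathlib's C^∞ monotone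
transition, `= 0` on `(−∞, 0]`, `= 1` on `[1, ∞)`). Ours, for non-vacuity; the paper fixes no formula («For instance
we take …»). [cite: MagnenRivasseauSeneor1993, §II.A p.330] -/
def standard : CutoffProfile where
  τ x := Real.smoothTransition (2 - x)
  contDiff n := Real.smoothTransition.contDiff.comp (contDiff_const.sub contDiff_id)
  antitone x y hxy := Real.smoothTransition.monotone (by linarith)
  eq_one_of_le_one x hx := Real.smoothTransition.one_of_one_le (by linarith)
  eq_zero_of_two_le x hx := Real.smoothTransition.zero_of_nonpos (by linarith)

end CutoffProfile

/-- (II.14), the ultraviolet cutoff `κ` as a function of `r = |p|`: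
*«κ(p) ≡ 1 if |p| ≤ 1, κ(p) ≡ (1 + τ(|p|))/2 if 1 < |p| ≤ 2, κ(p) ≡ 1/2 if 2 < |p| ≤ 2 + η⁻¹,
κ(p) ≡ (1/2)τ(|p| − 1 − η⁻¹) if 2 + η⁻¹ < |p|, where η is a small constant»* (Fig. II.1).
[cite: MagnenRivasseauSeneor1993, (II.14) p.331] -/
def cutoffFn (P : CutoffProfile) (η : ℝ) (r : ℝ) : ℝ :=
  if r ≤ 1 then 1
  else if r ≤ 2 then (1 + P.τ r) / 2
  else if r ≤ 2 + η⁻¹ then 1 / 2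
  else (1 / 2) * P.τ (r - 1 - η⁻¹)

section cutoff

variable (P : CutoffProfile) (η : ℝ)

/-- First line of (II.14). [cite: MagnenRivasseauSeneor1993, (II.14) p.331] -/
theorem cutoffFn_of_le_one {r : ℝ} (hr : r ≤ 1) : cutoffFn P η r = 1 := by
  simp [cutoffFn, hr]

/-- Second line of (II.14). [cite: MagnenRivasseauSeneor1993, (II.14) p.331] -/
theorem cutoffFn_of_one_lt_of_le_two {r : ℝ} (h1 : 1 < r) (h2 : r ≤ 2) :
    cutoffFn P η r = (1 + P.τ r) / 2 := by
  simp [cutoffFn, not_le.mpr h1, h2]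

/-- Third line of (II.14), the plateau at height `1/2` (needs `η > 0` only through `2 < 2 + η⁻¹`).
[cite: MagnenRivasseauSeneor1993, (II.14) p.331] -/
theorem cutoffFn_plateau {r : ℝ} (h2 : 2 < r) (h3 : r ≤ 2 + η⁻¹) : cutoffFn P η r = 1 / 2 := by
  have h1 : ¬ r ≤ 1 := by linarith
  have h2' : ¬ r ≤ 2 := not_le.mpr h2
  simp [cutoffFn, h1, h2', h3]

/-- Fourth line of (II.14), the tail. [cite: MagnenRivasseauSeneor1993, (II.14) p.331] -/
theorem cutoffFn_tail (hη : 0 < η) {r : ℝ} (h : 2 + η⁻¹ < r) :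
    cutoffFn P η r = (1 / 2) * P.τ (r - 1 - η⁻¹) := by
  have hη' : 0 < η⁻¹ := inv_pos.mpr hη
  have h1 : ¬ r ≤ 1 := by linarith
  have h2 : ¬ r ≤ 2 := by linarith
  simp [cutoffFn, h1, h2, not_le.mpr h]

/-- The pieces of (II.14) match at `|p| = 1`: `κ(1) = 1 = (1 + τ(1))/2`. [cite: MagnenRivasseauSeneor1993, (II.14) p.331] -/
theorem cutoffFn_one : cutoffFn P η 1 = 1 ∧ (1 + P.τ 1) / 2 = 1 := by
  refine ⟨cutoffFn_of_le_one P η le_rfl, ?_⟩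
  rw [P.τ_one]; norm_num

/-- The pieces of (II.14) match at `|p| = 2`: `κ(2) = (1 + τ(2))/2 = 1/2`. [cite: MagnenRivasseauSeneor1993, (II.14) p.331] -/
theorem cutoffFn_two : cutoffFn P η 2 = 1 / 2 := by
  rw [cutoffFn_of_one_lt_of_le_two P η one_lt_two le_rfl, P.τ_two]; norm_num

/-- The pieces of (II.14) match at `|p| = 2 + η⁻¹`: `κ = 1/2 = (1/2)τ(1)`. [cite: MagnenRivasseauSeneor1993, (II.14) p.331] -/
theorem cutoffFn_plateau_end (hη : 0 < η) :
    cutoffFn P η (2 + η⁻¹) = 1 / 2 ∧ (1 / 2) * P.τ ((2 + η⁻¹) - 1 - η⁻¹) = 1 / 2 := by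
  have hη' : 0 < η⁻¹ := inv_pos.mpr hη
  refine ⟨cutoffFn_plateau P η (by linarith) le_rfl, ?_⟩
  have : (2 + η⁻¹) - 1 - η⁻¹ = 1 := by ring
  rw [this, P.τ_one]; norm_num

/-- The cutoff vanishes from `|p| = 3 + η⁻¹` on (last abscissa mark of Fig. II.1).
[cite: MagnenRivasseauSeneor1993, (II.14) and Fig. II.1 p.331] -/
theorem cutoffFn_eq_zero_of_le (hη : 0 < η) {r : ℝ} (h : 3 + η⁻¹ ≤ r) : cutoffFn P η r = 0 := by
  have hη' : 0 < η⁻¹ := inv_pos.mpr hη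
  rw [cutoffFn_tail P η hη (by linarith), P.eq_zero_of_two_le _ (by linarith), mul_zero]

/-- `0 ≤ κ`. [cite: MagnenRivasseauSeneor1993, (II.14) p.331] -/
theorem cutoffFn_nonneg (r : ℝ) : 0 ≤ cutoffFn P η r := by
  unfold cutoffFn
  split_ifs
  · exact zero_le_one
  · linarith [P.τ_nonneg r]
  · norm_num
  · linarith [P.τ_nonneg (r - 1 - η⁻¹)]

/-- `κ ≤ 1`. [cite: MagnenRivasseauSeneor1993, (II.14) p.331] -/
theorem cutoffFn_le_one (r : ℝ) : cutoffFn P η r ≤ 1 := by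
  unfold cutoffFn
  split_ifs
  · exact le_rfl
  · linarith [P.τ_le_one r]
  · norm_num
  · linarith [P.τ_le_one (r - 1 - η⁻¹)]

/-- On the whole band `1 < |p| ≤ 2 + η⁻¹` the cutoff is at least `1/2` — the «unusual form» responsible for the
stabilizing `A⁴` counterterm (p.331 tl.9–12; the plateau mechanism itself is kernel-checked in
`…MRS93OneLoopCounterterms`, §5 there). [cite: MagnenRivasseauSeneor1993, (II.14) p.331] -/
theorem half_le_cutoffFn {r : ℝ} (h : r ≤ 2 + η⁻¹) : 1 / 2 ≤ cutoffFn P η r := by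
  unfold cutoffFn
  split_ifs
  · norm_num
  · linarith [P.τ_nonneg r]
  · exact le_rfl

end cutoff

/-! ## §3 The scaled cutoffs (II.13) and the slices (II.15) -/

/-- (II.13): *«κ_ρ(p) = κ(pM^{−ρ})»* — the cutoff at scale `M^ρ`, as a function of `r = |p|`.
[cite: MagnenRivasseauSeneor1993, (II.13) p.331] -/
def scaledCutoff (P : CutoffProfile) (η M : ℝ) (ρ : ℕ) (r : ℝ) : ℝ :=
  cutoffFn P η (r * M ^ (-(ρ : ℤ)))

/-- (II.15): *«κ^i = κ_i − κ_{i−1} if i ≥ 1; κ⁰ = κ₀»* — the momentum slices.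
[cite: MagnenRivasseauSeneor1993, (II.15) p.331] -/
def sliceCutoff (P : CutoffProfile) (η M : ℝ) : ℕ → ℝ → ℝ
  | 0 => scaledCutoff P η M 0
  | i + 1 => fun r => scaledCutoff P η M (i + 1) r - scaledCutoff P η M i r

/-- (II.15), `κ⁰ = κ₀`. [cite: MagnenRivasseauSeneor1993, (II.15) p.331] -/
@[simp] theorem sliceCutoff_zero (P : CutoffProfile) (η M : ℝ) :
    sliceCutoff P η M 0 = scaledCutoff P η M 0 := rfl

/-- (II.15), `κ^i = κ_i − κ_{i−1}` for `i ≥ 1`. [cite: MagnenRivasseauSeneor1993, (II.15) p.331] -/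
@[simp] theorem sliceCutoff_succ (P : CutoffProfile) (η M : ℝ) (i : ℕ) (r : ℝ) :
    sliceCutoff P η M (i + 1) r = scaledCutoff P η M (i + 1) r - scaledCutoff P η M i r := rfl

/-- The slices telescope back to the cutoff: `∑_{i=0}^{ρ} κ^i = κ_ρ` (the decomposition summed over in
(II.16)–(II.19), (II.22)). [cite: MagnenRivasseauSeneor1993, (II.15) p.331] -/
theorem sum_sliceCutoff (P : CutoffProfile) (η M : ℝ) (ρ : ℕ) (r : ℝ) :
    ∑ i ∈ Finset.range (ρ + 1), sliceCutoff P η M i r = scaledCutoff P η M ρ r := by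
  induction ρ with
  | zero => simp
  | succ n ih => rw [Finset.sum_range_succ, ih, sliceCutoff_succ]; ring

/-- At `ρ = 0` the scaled cutoff is `κ` itself. [cite: MagnenRivasseauSeneor1993, (II.13) p.331] -/
@[simp] theorem scaledCutoff_zero (P : CutoffProfile) (η M : ℝ) (r : ℝ) :
    scaledCutoff P η M 0 r = cutoffFn P η r := by
  simp [scaledCutoff]

/-- `0 ≤ κ_ρ ≤ 1`. [cite: MagnenRivasseauSeneor1993, (II.13)–(II.14) p.331] -/
theorem scaledCutoff_mem_Icc (P : CutoffProfile) (η M : ℝ) (ρ : ℕ) (r : ℝ) :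
    scaledCutoff P η M ρ r ∈ Set.Icc (0 : ℝ) 1 :=
  ⟨cutoffFn_nonneg P η _, cutoffFn_le_one P η _⟩

/-- `κ_ρ = 1` on `|p| ≤ M^ρ`: momenta below the cutoff scale are untouched.
[cite: MagnenRivasseauSeneor1993, (II.13)–(II.14) p.331] -/
theorem scaledCutoff_eq_one {M : ℝ} (P : CutoffProfile) (η : ℝ) (hM : 0 < M) (ρ : ℕ) {r : ℝ}
    (hr : r ≤ M ^ ρ) : scaledCutoff P η M ρ r = 1 := by
  unfold scaledCutoff
  apply cutoffFn_of_le_one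
  have hMρ : 0 < M ^ ρ := pow_pos hM ρ
  rw [zpow_neg, zpow_natCast]
  calc r * (M ^ ρ)⁻¹ ≤ M ^ ρ * (M ^ ρ)⁻¹ :=
        mul_le_mul_of_nonneg_right hr (inv_nonneg.mpr hMρ.le)
    _ = 1 := mul_inv_cancel₀ hMρ.ne'

/-- `κ_ρ = 0` on `|p| ≥ (3 + η⁻¹)M^ρ`: the cutoff at index `ρ` removes all momenta beyond scale `(3 + η⁻¹)M^ρ`.
[cite: MagnenRivasseauSeneor1993, (II.13)–(II.14) and Fig. II.1 p.331] -/
theorem scaledCutoff_eq_zero {M η : ℝ} (P : CutoffProfile) (hη : 0 < η) (hM : 0 < M) (ρ : ℕ) {r : ℝ}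
    (hr : (3 + η⁻¹) * M ^ ρ ≤ r) : scaledCutoff P η M ρ r = 0 := by
  unfold scaledCutoff
  apply cutoffFn_eq_zero_of_le P η hη
  have hMρ : 0 < M ^ ρ := pow_pos hM ρ
  rw [zpow_neg, zpow_natCast]
  calc 3 + η⁻¹ = (3 + η⁻¹) * M ^ ρ * (M ^ ρ)⁻¹ := by field_simp
    _ ≤ r * (M ^ ρ)⁻¹ := mul_le_mul_of_nonneg_right hr (inv_nonneg.mpr hMρ.le)

/-! ## §4 The anisotropic index set 𝐏 (p.334) -/

/-- `N_i` = *«the integer part of i − |ln(λ_i^t)/ln M|»* (p.334 tl.45), «integer part» rendered `⌊·⌋`, for the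
tentative coupling `lam = λ_i^t` at scale `i`. [cite: MagnenRivasseauSeneor1993, §II.B p.334] -/
def lowIndex (M lam : ℝ) (i : ℕ) : ℤ := ⌊(i : ℝ) - |Real.log lam / Real.log M|⌋

/-- The index set 𝐏: *«For every value of i = 1, …, ρ₁ we introduce an index α with integer values between N_i and
i+1 … The full set of ordered pairs (i, α) is called 𝐏»* (p.334 tl.44–47); `lam i` = the tentative coupling at scale
`i`. [cite: MagnenRivasseauSeneor1993, §II.B p.334] -/
def indexSet (M : ℝ) (lam : ℕ → ℝ) (ρ₁ : ℕ) : Set (ℕ × ℤ) :=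
  {j | 1 ≤ j.1 ∧ j.1 ≤ ρ₁ ∧ lowIndex M (lam j.1) j.1 ≤ j.2 ∧ j.2 ≤ (j.1 : ℤ) + 1}

/-- Membership in 𝐏, unfolded. [cite: MagnenRivasseauSeneor1993, §II.B p.334] -/
theorem mem_indexSet_iff (M : ℝ) (lam : ℕ → ℝ) (ρ₁ : ℕ) (i : ℕ) (α : ℤ) :
    (i, α) ∈ indexSet M lam ρ₁ ↔ 1 ≤ i ∧ i ≤ ρ₁ ∧ lowIndex M (lam i) i ≤ α ∧ α ≤ (i : ℤ) + 1 := Iff.rfl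

/-- The printed ordering on 𝐏 — *«j′ = (i′, α′) < j = (i, α) iff i′ < i or i′ = i and α′ < α»* (p.334 tl.48–49)
— is the lexicographic order `Prod.Lex`. [cite: MagnenRivasseauSeneor1993, §II.B p.334] -/
theorem indexSet_lt_iff (i i' : ℕ) (α α' : ℤ) :
    toLex (i', α') < toLex (i, α) ↔ i' < i ∨ (i' = i ∧ α' < α) := Prod.Lex.toLex_lt_toLex

/-- `N_i ≤ i` for every value of the coupling, so the printed range `N_i ≤ α ≤ i + 1` (p.334) is never empty.
[cite: MagnenRivasseauSeneor1993, §II.B p.334] -/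
theorem lowIndex_le (M lam : ℝ) (i : ℕ) : lowIndex M lam i ≤ i := by
  unfold lowIndex
  have h : (i : ℝ) - |Real.log lam / Real.log M| ≤ i := sub_le_self _ (abs_nonneg _)
  have := Int.floor_le_floor h
  simpa using this

/-- The pair `(i, i + 1)` lies in 𝐏 for every `1 ≤ i ≤ ρ₁`. [cite: MagnenRivasseauSeneor1993, §II.B p.334] -/
theorem top_mem_indexSet (M : ℝ) (lam : ℕ → ℝ) {ρ₁ i : ℕ} (h1 : 1 ≤ i) (h2 : i ≤ ρ₁) :
    (i, (i : ℤ) + 1) ∈ indexSet M lam ρ₁ := by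
  refine ⟨h1, h2, ?_, le_rfl⟩
  have := lowIndex_le M (lam i) i
  simp only
  omega

/-! ## §5 (v1.1) Monotonicity of `κ`, positivity and support of the slices -/

section slicing

variable (P : CutoffProfile) (η : ℝ)

/-- Beyond `|p| = 2` the cutoff is at most `1/2` (plateau, then `(1/2)τ ≤ 1/2`).
[cite: MagnenRivasseauSeneor1993, (II.14) p.331] -/
theorem cutoffFn_le_half_of_two_lt (hη : 0 < η) {s : ℝ} (hs : 2 < s) : cutoffFn P η s ≤ 1 / 2 := by
  rcases le_or_gt s (2 + η⁻¹) with h3 | h3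
  · rw [cutoffFn_plateau P η hs h3]
  · rw [cutoffFn_tail P η hη h3]
    linarith [P.τ_le_one (s - 1 - η⁻¹)]

/-- With «monotone decreasing» `τ`, the cutoff `κ` of (II.14) is monotone decreasing in `|p|` (Fig. II.1): the
four pieces decrease and their values match at `1`, `2`, `2 + η⁻¹`. [cite: MagnenRivasseauSeneor1993, (II.14) and Fig. II.1 p.331] -/
theorem cutoffFn_antitone (hη : 0 < η) : Antitone (cutoffFn P η) := by
  have hη' : 0 < η⁻¹ := inv_pos.mpr hη
  intro r s hrs
  rcases le_or_gt s 1 with hs1 | hs1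
  · rw [cutoffFn_of_le_one P η hs1, cutoffFn_of_le_one P η (hrs.trans hs1)]
  rcases le_or_gt r 1 with hr1 | hr1
  · rw [cutoffFn_of_le_one P η hr1]; exact cutoffFn_le_one P η s
  rcases le_or_gt s 2 with hs2 | hs2
  · rw [cutoffFn_of_one_lt_of_le_two P η hs1 hs2, cutoffFn_of_one_lt_of_le_two P η hr1 (hrs.trans hs2)]
    linarith [P.antitone hrs]
  rcases le_or_gt r 2 with hr2 | hr2
  · exact (cutoffFn_le_half_of_two_lt P η hη hs2).trans (half_le_cutoffFn P η (by linarith))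
  rcases le_or_gt s (2 + η⁻¹) with hs3 | hs3
  · rw [cutoffFn_plateau P η hs2 hs3, cutoffFn_plateau P η hr2 (hrs.trans hs3)]
  rcases le_or_gt r (2 + η⁻¹) with hr3 | hr3
  · rw [cutoffFn_plateau P η hr2 hr3]; exact cutoffFn_le_half_of_two_lt P η hη hs2
  · rw [cutoffFn_tail P η hη hs3, cutoffFn_tail P η hη hr3]
    have := P.antitone (show r - 1 - η⁻¹ ≤ s - 1 - η⁻¹ by linarith)
    linarith

variable (M : ℝ)

/-- The scaled cutoffs increase with the index: `κ_i(|p|) ≤ κ_{i+1}(|p|)` (`M ≥ 1`, `|p| ≥ 0`).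
[cite: MagnenRivasseauSeneor1993, (II.13)–(II.15) p.331] -/
theorem scaledCutoff_le_succ (hη : 0 < η) (hM : 1 ≤ M) (i : ℕ) {r : ℝ} (hr : 0 ≤ r) :
    scaledCutoff P η M i r ≤ scaledCutoff P η M (i + 1) r := by
  unfold scaledCutoff
  apply cutoffFn_antitone P η hη
  have hM0 : 0 < M := by linarith
  rw [zpow_neg, zpow_neg, zpow_natCast, zpow_natCast, pow_succ, mul_inv]
  have h1 : (M ^ i)⁻¹ * M⁻¹ ≤ (M ^ i)⁻¹ * 1 :=
    mul_le_mul_of_nonneg_left (inv_le_one_of_one_le₀ hM) (inv_nonneg.mpr (pow_pos hM0 i).le)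
  calc r * ((M ^ i)⁻¹ * M⁻¹) ≤ r * ((M ^ i)⁻¹ * 1) := mul_le_mul_of_nonneg_left h1 hr
    _ = r * (M ^ i)⁻¹ := by rw [mul_one]

/-- The slices (II.15) are nonnegative: `κ^i ≥ 0` (`M ≥ 1`, `|p| ≥ 0`) — (II.15) is a genuine partition of the
cutoff into positive pieces. [cite: MagnenRivasseauSeneor1993, (II.15) p.331] -/
theorem sliceCutoff_nonneg (hη : 0 < η) (hM : 1 ≤ M) (i : ℕ) {r : ℝ} (hr : 0 ≤ r) :
    0 ≤ sliceCutoff P η M i r := by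
  cases i with
  | zero => exact cutoffFn_nonneg P η _
  | succ k =>
    rw [sliceCutoff_succ]
    linarith [scaledCutoff_le_succ P η M hη hM k hr]

/-- The slices are bounded by `1`. [cite: MagnenRivasseauSeneor1993, (II.15) p.331] -/
theorem sliceCutoff_le_one (i : ℕ) (r : ℝ) : sliceCutoff P η M i r ≤ 1 := by
  cases i with
  | zero => exact cutoffFn_le_one P η _
  | succ k =>
    rw [sliceCutoff_succ]
    have h1 : scaledCutoff P η M (k + 1) r ≤ 1 := (scaledCutoff_mem_Icc P η M (k + 1) r).2
    have h2 : 0 ≤ scaledCutoff P η M k r := (scaledCutoff_mem_Icc P η M k r).1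
    linarith

/-- Support of the slices, lower edge: slice `i + 1` vanishes on `|p| ≤ M^i` (both scaled cutoffs equal `1`
there). [cite: MagnenRivasseauSeneor1993, (II.13)–(II.15) p.331] -/
theorem sliceCutoff_succ_eq_zero_of_le (hM : 1 ≤ M) (i : ℕ) {r : ℝ} (hr : r ≤ M ^ i) :
    sliceCutoff P η M (i + 1) r = 0 := by
  have hM0 : 0 < M := by linarith
  have hr' : r ≤ M ^ (i + 1) := hr.trans (pow_le_pow_right₀ hM (Nat.le_succ i))
  rw [sliceCutoff_succ, scaledCutoff_eq_one P η hM0 (i + 1) hr', scaledCutoff_eq_one P η hM0 i hr, sub_self]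

/-- Support of the slices, upper edge: slice `i + 1` vanishes on `|p| ≥ (3 + η⁻¹)M^{i+1}` (both scaled cutoffs
vanish there). [cite: MagnenRivasseauSeneor1993, (II.13)–(II.15) and Fig. II.1 p.331] -/
theorem sliceCutoff_succ_eq_zero_of_ge (hη : 0 < η) (hM : 1 ≤ M) (i : ℕ) {r : ℝ}
    (hr : (3 + η⁻¹) * M ^ (i + 1) ≤ r) : sliceCutoff P η M (i + 1) r = 0 := by
  have hM0 : 0 < M := by linarith
  have h3 : 0 ≤ 3 + η⁻¹ := by have := inv_pos.mpr hη; linarith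
  have hr' : (3 + η⁻¹) * M ^ i ≤ r :=
    (mul_le_mul_of_nonneg_left (pow_le_pow_right₀ hM (Nat.le_succ i)) h3).trans hr
  rw [sliceCutoff_succ, scaledCutoff_eq_zero P hη hM0 (i + 1) hr, scaledCutoff_eq_zero P hη hM0 i hr', sub_self]

end slicing

/-! ## §6 (v1.2) The covariance symbols `C₀⁻¹` (II.16) and `C_axial⁻¹` (II.19) -/

section covariance

variable (P : CutoffProfile) (η M : ℝ) (lam : ℕ → ℝ) (ρ₁ : ℕ)

/-- (II.16) with the sum stopped at the fake cutoff `ρ₁` (II.18): the momentum-space symbol of `C₀⁻¹`,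
`p² Σ_{i=0}^{ρ₁} (λ_i^t)² κ^i(|p|)`, as a function of `psq = p²` (`lam i = λ_i^t`).
[cite: MagnenRivasseauSeneor1993, (II.16) p.332 and (II.18) p.332 tl.20–21] -/
def invC0 (psq : ℝ) : ℝ :=
  psq * ∑ i ∈ Finset.range (ρ₁ + 1), lam i ^ 2 * sliceCutoff P η M i (Real.sqrt psq)

/-- (II.19): the symbol of `C_axial⁻¹`, `p₀² + p² Σ_i (λ_i^t)² κ^i(|p|)`.
[cite: MagnenRivasseauSeneor1993, (II.19) p.332] -/
def invCaxial (p0 psq : ℝ) : ℝ := p0 ^ 2 + invC0 P η M lam ρ₁ psq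

/-- `C₀⁻¹ ≥ 0` (`η > 0`, `M ≥ 1`, `p² ≥ 0`): the slices are nonnegative.
[cite: MagnenRivasseauSeneor1993, (II.16) p.332] -/
theorem invC0_nonneg (hη : 0 < η) (hM : 1 ≤ M) {psq : ℝ} (hpsq : 0 ≤ psq) :
    0 ≤ invC0 P η M lam ρ₁ psq := by
  unfold invC0
  refine mul_nonneg hpsq (Finset.sum_nonneg fun i _ => ?_)
  exact mul_nonneg (sq_nonneg _) (sliceCutoff_nonneg P η M hη hM i (Real.sqrt_nonneg _))

/-- The point of (II.19): `C_axial⁻¹ > 0` as soon as `p₀ ≠ 0` — *«The quadratic form p₀² is not invertible when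
p₀ = 0 and in order to have a good propagator we add …»* (p.331 tl.18–19). [cite: MagnenRivasseauSeneor1993, (II.19) p.332 and p.331 tl.18–19] -/
theorem invCaxial_pos (hη : 0 < η) (hM : 1 ≤ M) {p0 psq : ℝ} (hp0 : p0 ≠ 0) (hpsq : 0 ≤ psq) :
    0 < invCaxial P η M lam ρ₁ p0 psq := by
  unfold invCaxial
  have := invC0_nonneg P η M lam ρ₁ hη hM hpsq
  positivity

/-- Below the unit scale only slice `0` contributes: for `p² ≤ 1`, `C₀⁻¹(p) = p²(λ_0^t)²` (`M ≥ 1`).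
[cite: MagnenRivasseauSeneor1993, (II.13)–(II.16) pp.331–332] -/
theorem invC0_of_sq_le_one (hM : 1 ≤ M) {psq : ℝ} (h1 : psq ≤ 1) :
    invC0 P η M lam ρ₁ psq = psq * lam 0 ^ 2 := by
  unfold invC0
  have hM0 : 0 < M := by linarith
  have hr : Real.sqrt psq ≤ 1 := Real.sqrt_le_one.mpr h1
  rw [Finset.sum_range_succ', Finset.sum_eq_zero]
  · simp [cutoffFn_of_le_one P η hr]
  · intro i _
    rw [sliceCutoff_succ_eq_zero_of_le P η M hM i (hr.trans (one_le_pow₀ hM)), mul_zero]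

/-- Beyond the support of the fake cutoff, `|p| ≥ (3 + η⁻¹)M^{ρ₁}`, the symbol vanishes: `dμ_{0,ρ₁}` carries no
modes there. [cite: MagnenRivasseauSeneor1993, (II.13)–(II.16), (II.18) pp.331–332] -/
theorem invC0_eq_zero_of_ge (hη : 0 < η) (hM : 1 ≤ M) {psq : ℝ}
    (h : (3 + η⁻¹) * M ^ ρ₁ ≤ Real.sqrt psq) : invC0 P η M lam ρ₁ psq = 0 := by
  unfold invC0
  have hM0 : 0 < M := by linarith
  have h3 : 0 ≤ 3 + η⁻¹ := by have := inv_pos.mpr hη; linarith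
  rw [Finset.sum_eq_zero, mul_zero]
  intro i hi
  have hi' : i ≤ ρ₁ := Nat.lt_succ_iff.mp (Finset.mem_range.mp hi)
  have hle : (3 + η⁻¹) * M ^ i ≤ Real.sqrt psq :=
    (mul_le_mul_of_nonneg_left (pow_le_pow_right₀ hM hi') h3).trans h
  cases i with
  | zero =>
    rw [sliceCutoff_zero, scaledCutoff_eq_zero P hη hM0 0 hle, mul_zero]
  | succ k =>
    rw [sliceCutoff_succ_eq_zero_of_ge P η M hη hM k hle, mul_zero]

end covariance

end Ansatz

end Literature.MathematicalPhysics.QuantumFieldTheory.MagnenRivasseauSeneor1993
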